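import Literature.AnabelianGeometry.EtaleTheta.ThetaCoversTempered

/-!
# Orbits of `l`-th roots of the étale theta class ([EtTh] §2: the discussion of pp.40–41,
# Cor 2.8 (i), (iii); Cor 2.8 (ii) and Rmk 2.9.2 recorded as documentation)

Mochizuki, *The Étale Theta Function …* [EtTh], Publ. RIMS 45 (2009), §2, PRIMS text pp.40–43
(locators = PDF pages; bib key `MochizukiEtTh2009`). Underline decorations of the orbit symbols were
read on the kurims render (`paper:url-b1bf576d3169` p.38), which separates decorated symbols: in
Cor 2.8 (i) the four collections are `η̲̈^{Θ,l·ℤ×μ₂}` (resp. `η̈^{Θ,ℤ×μ₂}`; `η̲̈^{Θ,l·ℤ×μ₂}`;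
`η̈^{Θ,l·ℤ×μ₂}`) for `γ` an automorphism of `Π^tp` of `X̲̲` (resp. `X̲`; `C̲̲`; `C̲`), with ambiguity
a root of unity of order `l` (resp. `1`; `l`; `1`); in (iii) the preserved orbits are `η̲̈^{Θ,l·ℤ}`
(resp. `η̈^{Θ,l·ℤ}`; `η̲̈^{Θ,l·ℤ}`; `η̈^{Θ,l·ℤ}`).

Interface `ThetaOrbitData T` over `ThetaCovers.TemperedCoverData` (TODO-merge(abc-iut-L2-t1): the étale
theta class `η̈^Θ ∈ H¹(Π^tp_Ÿ, Δ_Θ)` of Prop 1.3 and "standard type" (Def 1.9 (ii)) are t1's): the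
cyclotome `Δ_Θ` as a SUBQUOTIENT of `Π^tp_C` (so automorphisms of `Π^tp_C` stabilising it act on it
canonically), and the printed orbit collections as sets of cohomology classes, a class being its set of
continuous cocycles. "Standard type" is a property OF these collections (no predicate parameter). Convention
for "γ preserves the property … — a property that determines the collection up to multiplication by a
root of unity of order `n`": the transported collection is the twist of the original by an inflated
`G_K`-class killed by `n` (the Kummer classes of `μ_n(K)`, cf. `ThetaSystems.Cor219_iii`).

NOT typed (documentation only): Cor 2.8 (ii) and Rmk 2.9.2 — the "`μ_N`-structure on the
`(K^×)^∧`-torsor at a cusp" and the "canonical integral structure" are notions of [GalSect] = [Mzk13]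
(Cor 4.12, Def 4.1 (iii)) that no seat has typed; recorded in HANDOFF.
-/

namespace Literature.AnabelianGeometry.EtaleTheta

namespace ThetaCovers

universe u

open TemperedCoverData

/-- **Interface (pp.40–41)**: the coefficient cyclotome `Δ_Θ` as the subquotient `top/bot` of `Π^tp_C`
(inverse images of `Δ_Θ ⊆ (Δ^tp_X)^Θ` and of `1`, i.e. `bot = Ker(Π^tp_X ↠ (Π^tp_X)^Θ)`), and the
orbit collections of p.41: `η̈^{Θ,ℤ×μ₂}` ⊇ `η̈^{Θ,l·ℤ×μ₂}` ⊇ `η̈^{Θ,l·ℤ}` (classes on `Π^tp_Ÿ`) and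
`η̲̈^{Θ,l·ℤ×μ₂}` ⊇ `η̲̈^{Θ,l·ℤ}` (classes of `l`-th roots, on `Π^tp_{Ÿ̲̲} = Π^tp_Ÿ ∩ Π^tp_{X̲̲}`); "upon
restriction to `Ÿ̲̲`, `η̈^Θ` determines `η̲̈^Θ ∈ H¹(Π^tp_{Ÿ̲̲}, l·Δ_Θ)` with `l · η̲̈^Θ = η̈^Θ|_{Ÿ̲̲}`"
(p.41). TODO-merge(abc-iut-L2-t1). [cite: MochizukiEtTh2009, Def 2.7 p.41] -/
structure ThetaOrbitData {l : ℕ} (T : TemperedCoverData.{u} l) : Type u where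
  /-- inverse image in `Π^tp_C` of `Δ_Θ ⊆ (Π^tp_X)^Θ` -/
  top : Subgroup T.Gtp
  /-- `Ker(Π^tp_X ↠ (Π^tp_X)^Θ)` as a subgroup of `Π^tp_C` -/
  bot : Subgroup T.Gtp
  /-- `bot ⊆ top` -/
  bot_le : bot ≤ top
  /-- both are normal in `Π^tp_C` (`Δ_Θ` is a characteristic subquotient) … -/
  top_normal : top.Normal
  /-- … -/
  bot_normal : bot.Normal
  /-- `Δ_Θ ⊆ Δ^tp_Ÿ`: `top ⊆ Π^tp_Ÿ ∩ Δ` -/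
  top_le : top ≤ T.PiYddtp ⊓ (T.aug.comp T.toHat).ker
  /-- the decomposition groups in `Π^tp_{Ÿ̲̲}` of the points of `Ÿ̲̲` lying over the 4-torsion points
  `τ^{±1}` ("`√−1`", Def 1.9, p.29) — the data at which the "standard sets of values" are read -/
  Dtau : Set (Subgroup T.Gtp)
  /-- … contained in `Π^tp_{Ÿ̲̲}` … -/
  Dtau_le : ∀ D ∈ Dtau, D ≤ T.PiYddtp ⊓ T.tp T.PiXuu
  /-- … there are such points (`√−1 ∈ K`, p.29) … -/
  Dtau_nonempty : Dtau.Nonempty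
  /-- … and each `D` (decomposition group of a closed point) maps injectively onto a finite-index
  subgroup of `G_K` (vacuity guard against `D = ⊥`; audit abc-iut-L6-t23) -/
  Dtau_aug : ∀ D ∈ Dtau, Set.InjOn (T.aug.comp T.toHat) D ∧ (D.map (T.aug.comp T.toHat)).FiniteIndex
  /-- `η̈^{Θ,ℤ×μ₂}`: the `(ℤ × μ₂)`-orbit of classes (p.41), each class a set of cocycles `Π^tp_Ÿ → Δ_Θ` -/
  etaZMu2 : Set (Set (↥T.PiYddtp → ↥top ⧸ bot.subgroupOf top))
  /-- `η̈^{Θ,l·ℤ×μ₂} ⊆ η̈^{Θ,ℤ×μ₂}` -/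
  etaLZMu2 : Set (Set (↥T.PiYddtp → ↥top ⧸ bot.subgroupOf top))
  /-- `η̈^{Θ,l·ℤ} ⊆ η̈^{Θ,l·ℤ×μ₂}` -/
  etaLZ : Set (Set (↥T.PiYddtp → ↥top ⧸ bot.subgroupOf top))
  /-- the inclusions -/
  etaLZ_sub : etaLZ ⊆ etaLZMu2 ∧ etaLZMu2 ⊆ etaZMu2
  /-- `η̲̈^{Θ,l·ℤ×μ₂}`: classes of `l`-th roots on `Π^tp_{Ÿ̲̲}` -/
  rootLZMu2 : Set (Set (↥(T.PiYddtp ⊓ T.tp T.PiXuu) → ↥top ⧸ bot.subgroupOf top))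
  /-- `η̲̈^{Θ,l·ℤ} ⊆ η̲̈^{Θ,l·ℤ×μ₂}` -/
  rootLZ : Set (Set (↥(T.PiYddtp ⊓ T.tp T.PiXuu) → ↥top ⧸ bot.subgroupOf top))
  /-- the inclusion -/
  rootLZ_sub : rootLZ ⊆ rootLZMu2
  /-- "`l · η̲̈^Θ = η̈^Θ|_{Ÿ̲̲}`": every root class is an `l`-th root of the restriction of a class -/
  root_pow : ∀ c ∈ rootLZMu2, ∀ ξ ∈ c, ∃ c' ∈ etaLZMu2, ∃ η ∈ c',
    ∀ g : ↥(T.PiYddtp ⊓ T.tp T.PiXuu), (ξ g) ^ l = η ⟨g, g.2.1⟩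

namespace ThetaOrbitData

variable {l : ℕ} {T : TemperedCoverData.{u} l} (O : ThetaOrbitData T)

/-- Normality instance for the subquotient. [cite: MochizukiEtTh2009, Def 2.7 p.41] -/
instance : (O.bot.subgroupOf O.top).Normal := O.bot_normal.subgroupOf _

/-- The cyclotome `Δ_Θ = top/bot`. [cite: MochizukiEtTh2009, Def 2.7 p.41] -/
abbrev DeltaTheta : Type u := ↥O.top ⧸ O.bot.subgroupOf O.top

/-- An automorphism `Γ` of `Π^tp_C` stabilising `top` and `bot` induces an automorphism of
`Δ_Θ = top/bot`, here as a relation `Γ ↦ Γ_Θ`. [cite: MochizukiEtTh2009, Cor 2.8(i) p.42] -/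
def InducesOnTheta (Γ : T.Gtp ≃ₜ* T.Gtp) (ΓΘ : O.DeltaTheta ≃* O.DeltaTheta) : Prop :=
  ∃ hΓ : O.top.map Γ.toMulEquiv.toMonoidHom = O.top,
    ∀ d : ↥O.top, ΓΘ (QuotientGroup.mk d) =
      QuotientGroup.mk ⟨Γ d, hΓ.le (Subgroup.mem_map.mpr ⟨d, d.2, rfl⟩)⟩

/-- Transport of a collection of classes of cocycles on an open subgroup `H` stabilised by `Γ`, with
coefficient automorphism `ΓΘ`: `(Γ·η)(g) = ΓΘ⁻¹(η(Γ g))`.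
[cite: MochizukiEtTh2009, Cor 2.8(i) p.42] -/
def transport (H : Subgroup T.Gtp) (Γ : T.Gtp ≃ₜ* T.Gtp)
    (hH : H.map Γ.toMulEquiv.toMonoidHom = H) (ΓΘ : O.DeltaTheta ≃* O.DeltaTheta)
    (C : Set (Set (↥H → O.DeltaTheta))) : Set (Set (↥H → O.DeltaTheta)) :=
  (fun c => (fun η => fun g => ΓΘ.symm (η ⟨Γ g, hH.le (Subgroup.mem_map.mpr ⟨g, g.2, rfl⟩)⟩)) '' c)
    '' C

/-- The conjugation action of `Π^tp_C` on the subquotient `Δ_Θ = top/bot` (the cyclotomic character,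
through `G_K`). [cite: MochizukiEtTh2009, Cor 2.8(i) p.42] -/
def act (x : T.Gtp) : O.DeltaTheta →* O.DeltaTheta :=
  haveI := O.top_normal
  QuotientGroup.map _ _ (MulAut.conjNormal (H := O.top) x).toMonoidHom (fun d hd => by
    rw [Subgroup.mem_comap, Subgroup.mem_subgroupOf]
    rw [Subgroup.mem_subgroupOf] at hd
    simpa using O.bot_normal.conj_mem _ hd x)

/-- Twist of a collection by a `Δ_Θ`-valued function `κ` on `Π^tp_C` INFLATED from `G_K` (a
"multiplication by an element of `K^×`": its Kummer class): `η ↦ η · κ`.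
[cite: MochizukiEtTh2009, Cor 2.8(i) p.42] -/
def twist (H : Subgroup T.Gtp) (κ : T.Gtp → O.DeltaTheta) (C : Set (Set (↥H → O.DeltaTheta))) :
    Set (Set (↥H → O.DeltaTheta)) :=
  (fun c => (fun η => fun g => η g * κ g) '' c) '' C

/-- "Up to multiplication by a root of unity of order (dividing) `n`": the two collections differ by the
twist by an inflated 1-COCYCLE `κ` (for the conjugation action on `Δ_Θ`) whose CLASS is killed by `n` —
`κ^n` is a coboundary (NOT `κ^n = 1` pointwise: `Δ_Θ ≅ Ẑ(1)` is torsion-free; audit L6-t23).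
[cite: MochizukiEtTh2009, Cor 2.8(i) p.42] -/
def EqUpToRootOfUnity (n : ℕ) (H : Subgroup T.Gtp) (C C' : Set (Set (↥H → O.DeltaTheta))) : Prop :=
  ∃ κ : T.Gtp → O.DeltaTheta,
    (∀ x y, T.aug (T.toHat x) = T.aug (T.toHat y) → κ x = κ y) ∧
    (∀ x y, κ (x * y) = κ x * O.act x (κ y)) ∧
    (∃ d : O.DeltaTheta, ∀ x, κ x ^ n = O.act x d * d⁻¹) ∧ C' = O.twist H κ C

/-! ## "Of standard type" (Def 1.9 (ii), Def 2.7) and Corollary 2.8 (i), (iii) -/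

/-- **Definition 1.9 (ii) / 2.7, group-theoretically**: `η̈^{Θ,ℤ×μ₂}` is *of standard type* iff "the
unique value `∈ O_K^×` of maximal order of some standard set of values `η̈^{Θ,ℤ}|_τ, η̈^{Θ,ℤ}|_{τ⁻¹}
⊆ K^×`" is `±1` — equivalently (the values in a standard set are `±1`·(powers of `q`)·(one unit), and
the torsion of `(K^×)^∧ = H¹(G_K, Δ_Θ)` is `μ(K)`): SOME class of the collection restricts, on SOME
decomposition group `D ∈ Dtau`, to a class killed by `2` (the Kummer class of `±1`). A CONCRETE predicate
on collections of classes on `Π^tp_Ÿ` (no `Prop` stub; reviews of p406501/p406836).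
[cite: MochizukiEtTh2009, Def 2.7 p.41] -/
def IsStandardColl (C : Set (Set (↥T.PiYddtp → O.DeltaTheta))) : Prop :=
  ∃ D, ∃ hD : D ∈ O.Dtau, ∃ c ∈ C, ∃ η ∈ c, ∃ d : O.DeltaTheta,
    ∀ (g : T.Gtp) (hg : g ∈ D), η ⟨g, (O.Dtau_le D hD hg).1⟩ ^ 2 = O.act g d * d⁻¹

/-- `η̈^{Θ,ℤ×μ₂}` (hence, Def 2.7, every orbit collection of `O`) is of standard type.
[cite: MochizukiEtTh2009, Def 2.7 p.41] -/
def IsStandard : Prop := O.IsStandardColl O.etaZMu2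

/-- **Corollary 2.8 (i)** (Constant Multiple Rigidity of Roots of the Étale Theta Function): for `γ`
an automorphism of `Π^tp` of `X̲̲` (resp. `X̲`; `C̲̲`; `C̲`), extended to `Π^tp_C` by Prop 2.4, "`γ`
preserves the property that `η̲̈^{Θ,l·ℤ×μ₂}` (resp. `η̈^{Θ,ℤ×μ₂}`; `η̲̈^{Θ,l·ℤ×μ₂}`; `η̈^{Θ,l·ℤ×μ₂}`) be of
standard type — a property that determines this collection of classes up to multiplication by a root
of unity of order `l` (resp. `1`; `l`; `1`)" — typed UNDER the standard-type hypothesis `IsStandard`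
(concrete, above; `Dtau` assumed `Γ`-stable as printed: "`γ` maps [the decomposition groups over] `τ` to
[those over] `τ^{±1}`", proof of Thm 1.10): the transported object is again of standard type and the
transported collection differs from the original by a root of unity of the stated order
(`EqUpToRootOfUnity`). [cite: MochizukiEtTh2009, Cor 2.8(i) p.42] -/
def Cor28_i : Prop :=
  O.IsStandard →
  ∀ (Γ : T.Gtp ≃ₜ* T.Gtp) (ΓΘ : O.DeltaTheta ≃* O.DeltaTheta), O.InducesOnTheta Γ ΓΘ →
    (∀ D ∈ O.Dtau, D.map Γ.toMulEquiv.toMonoidHom ∈ O.Dtau) →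
    ∀ (hY : T.PiYddtp.map Γ.toMulEquiv.toMonoidHom = T.PiYddtp)
      (hYuu : (T.PiYddtp ⊓ T.tp T.PiXuu).map Γ.toMulEquiv.toMonoidHom = T.PiYddtp ⊓ T.tp T.PiXuu),
    -- "`γ` preserves the property … of standard type"
    O.IsStandardColl (O.transport _ Γ hY ΓΘ O.etaZMu2) ∧
    -- `γ` on `Π^tp_{X̲̲}` or on `Π^tp_{C̲̲}` (their Prop 2.4 lists coincide): `η̲̈^{Θ,l·ℤ×μ₂}`, order `l`
    ((∀ S ∈ T.tower, S.map Γ.toMulEquiv.toMonoidHom = S) →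
      O.EqUpToRootOfUnity l _ O.rootLZMu2 (O.transport _ Γ hYuu ΓΘ O.rootLZMu2)) ∧
    -- `γ` on `Π^tp_{X̲}`: `η̈^{Θ,ℤ×μ₂}`, order `1`
    ((∀ S ∈ [T.tp T.PiXu, T.tp T.PiX, T.PiYddtp], S.map Γ.toMulEquiv.toMonoidHom = S) →
      O.EqUpToRootOfUnity 1 _ O.etaZMu2 (O.transport _ Γ hY ΓΘ O.etaZMu2)) ∧
    -- `γ` on `Π^tp_{C̲}`: `η̈^{Θ,l·ℤ×μ₂}`, order `1`
    ((∀ S ∈ [T.tp T.PiCu, T.tp T.PiXu, T.tp T.PiX, T.PiYddtp], S.map Γ.toMulEquiv.toMonoidHom = S) →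
      O.EqUpToRootOfUnity 1 _ O.etaLZMu2 (O.transport _ Γ hY ΓΘ O.etaLZMu2))

/-- Inner automorphism of `Π^tp_C` by `x` (the "`γ` arising from an inner automorphism" of (iii)).
[cite: MochizukiEtTh2009, Cor 2.8(iii) p.42] -/
def innerAutTop {l : ℕ} {T : TemperedCoverData.{u} l} (x : T.Gtp) : T.Gtp ≃ₜ* T.Gtp :=
  { MulAut.conj x with
    continuous_toFun := by
      change Continuous fun h => x * h * x⁻¹
      fun_prop
    continuous_invFun := by
      change Continuous fun h => x⁻¹ * h * x
      fun_prop }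

/-- **Corollary 2.8 (iii)**: "if the data for `α, β` are equal, and `γ` arises from an inner automorphism of
`Π^tp_{Ẋ̲̲}` (resp. `Π^tp_{Ẋ̲}`; `Π^tp_{Ċ̲̲}`; `Π^tp_{Ċ̲}`), then `γ` preserves `η̲̈^{Θ,l·ℤ}` (resp. `η̈^{Θ,l·ℤ}`;
`η̲̈^{Θ,l·ℤ}`; `η̈^{Θ,l·ℤ}`) [i.e., without any constant multiple indeterminacy]" — conjugation by an
element of the dotted group, with its induced coefficient automorphism, maps the orbit to itself.
[cite: MochizukiEtTh2009, Cor 2.8(iii) p.42] -/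
def Cor28_iii : Prop :=
  ∀ (x : T.Gtp) (ΓΘ : O.DeltaTheta ≃* O.DeltaTheta), O.InducesOnTheta (innerAutTop x) ΓΘ →
    ∀ (hY : T.PiYddtp.map (innerAutTop x).toMulEquiv.toMonoidHom = T.PiYddtp)
      (hYuu : (T.PiYddtp ⊓ T.tp T.PiXuu).map (innerAutTop x).toMulEquiv.toMonoidHom =
        T.PiYddtp ⊓ T.tp T.PiXuu),
    (x ∈ T.tp T.PiXuu ⊓ T.PiCdot → O.transport _ _ hYuu ΓΘ O.rootLZ = O.rootLZ) ∧
    (x ∈ T.tp T.PiXu ⊓ T.PiCdot → O.transport _ _ hY ΓΘ O.etaLZ = O.etaLZ) ∧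
    (x ∈ T.tp T.PiCuu ⊓ T.PiCdot → O.transport _ _ hYuu ΓΘ O.rootLZ = O.rootLZ) ∧
    (x ∈ T.tp T.PiCu ⊓ T.PiCdot → O.transport _ _ hY ΓΘ O.etaLZ = O.etaLZ)

/-! ### Corollary 2.8 (ii) and Remark 2.9.2 (pp.42–43) — NOT typed (documentation): "(ii) Suppose
further that the cusps of `X̲_□` are rational over `K_□`, that the residue characteristic of `K_□` is
prime to `l`, and that `K_□` contains a primitive `l`-th root of unity. Then the `{±1}`-[i.e., `μ₂`-]
structure of Theorem 1.10, (iii), determines a `μ_{2l}` (resp. `μ₂`; `μ_{2l}`; `μ₂`)-structure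
[cf. [GalSect], Corollary 4.12] on the `(K^×_□)^∧`-torsor at the cusps … compatible with the canonical
integral structure [cf. [GalSect], Definition 4.1, (iii)] determined by the stable model of `X^log_□`
and preserved by `γ`"; Rmk 2.9.2 describes how the `2l` (resp. `2`) trivialisations are permuted by the
cusp stabilisers in `Aut_K(−)`. The torsor/`μ_N`-structure notions of [GalSect] have no owner seat;
recorded in HANDOFF of abc-iut-L2-t2. -/

end ThetaOrbitData

end ThetaCovers

end Literature.AnabelianGeometry.EtaleTheta
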